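import Summits.NavierStokesRegularity.OSWSelfSimilar.SheetRWeakProfilePV
import Summits.NavierStokesRegularity.OSWSelfSimilar.SheetRStrongZeroBlowup
import Summits.NavierStokesRegularity.OSWSelfSimilar.SheetRWeightedEmbeddings
import Literature.Analysis.FunctionSpaces.DistributionalConstancy
import Mathlib.MeasureTheory.Integral.IntervalIntegral.AbsolutelyContinuousFun
import Mathlib.MeasureTheory.Integral.IntervalIntegral.LebesgueDifferentiationThm
import Mathlib.Analysis.Calculus.Deriv.Support
import HarnessLib

/-!
# SHEET-ℝ weak→classical bridge: an `E`-weak zero of the certificate's profile map `G` is a `C² ∩ L¹` strong zero, hence an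
# exact self-similar VISCOUS gCLM blow-up

HONEST FRAMING (cell ns-blowup GROUP B / zone Z3, case Z3-SR-CERT; 1-D MODEL (viscous gCLM/OSW on the line at the NS-type similarity
exponent `c_l = 1/2`); not Euler, not Navier–Stokes; «violates: none — MODEL»). NOTHING here asserts that a profile exists: every theorem is
an implication from a weak zero.

THE GAP THIS FILE CLOSES. The certificate of record (`CertificateViscousSheetR.lean` + `CertificateViscousSheetRChain.lean`: Newton–Kantorovich
in the energy space `E = H¹_{L²+ξ²}` with the dual pairing `⟨·, w·⟩`) yields a zero `Ω*` of
  `G(Ω) = Ω + ½ξΩ′ + a·𝒰Ω·Ω′ − (HΩ)·Ω − νΩ″`,  `𝒰Ω(ξ) = ∫₀^ξ HΩ`,  `H = Literature.Analysis.Fourier.hilbertTransform`,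
in the WEAK sense: `Ω* ∈ E` is only `H¹`, and `G(Ω*) = 0` in `E*`.  The blow-up theorem
`SheetRStrongZeroBlowup.exact_viscous_selfSimilar_blowup_of_strongZero` needs `Ω ∈ C² ∩ L¹` with `G(Ω)(X) = 0` at EVERY `X`.

INPUT (the typed «`E`-weak zero», `H¹` data written as a primitive): `Ω = Ω(0) + ∫₀^ξ Ω₁` with `Ω₁ ∈ L²`, `Ω ∈ L¹ ∩ L²`, `ν ≠ 0`, and
  `∀ ψ ∈ C_c^∞(ℝ):  ∫ (Ω + ½ξΩ₁ + a·𝒰Ω·Ω₁ − HΩ·Ω)·ψ + ν ∫ Ω₁·ψ′ = 0`                                    (W)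
— the restriction of `⟨G(Ω), φ⟩ = 0 ∀φ ∈ E` to smooth compactly supported tests (`wφ` runs over `C_c^∞` with `φ`), with `−νΩ″` moved onto the
test function. For such `Ω` the p.v. `HΩ` converges absolutely at every point and `HΩ ∈ L²` (`SheetRWeakProfilePV`), so (W) is a statement
about the tree's pointwise operator.  For data literally in the certificate's space — `∫(L² + ξ²)Ω² < ∞`, `∫(L² + ξ²)Ω₁² < ∞` — the `L¹ ∩ L²`
clauses are automatic (`…_of_energyData`, via `SheetRWeightedEmbeddings`).
OUTPUT: `Ω ∈ C²` and `G(Ω)(X) = 0` for every `X` (`contDiff_two_and_strongZero_of_weakZero`); hence (`exact_viscous_selfSimilar_blowup_of_weakZero`,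
`…_fifth` at `(a, ν) = (1/5, 1)`) a not-identically-zero weak zero gives, for every `T > 0`, an exact self-similar classical solution of
`ω_t + a u ω_x = u_x ω + ν ω_xx` on `ℝ × [0, T)` whose sup norm blows up at `T`.
PROOF (1-D regularity bootstrap, kernel): `F := Ω + ½ξΩ₁ + a𝒰Ω·Ω₁ − HΩ·Ω ∈ L¹_loc`; integration by parts against the absolutely continuous
primitive `P = ∫₀F` (Mathlib `AbsolutelyContinuousOnInterval.integral_mul_deriv_eq_deriv_mul` + Lebesgue differentiation) turns (W) into
`∫ η′(νΩ₁ − P) = 0` on every window, so `νΩ₁ = P + c` a.e. (du Bois-Reymond, `Literature.Analysis.FunctionSpaces.ae_eq_const_of_forall_setIntegral_deriv_mul_eq_zero`),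
whence `Ω ∈ C¹` with `Ω′ = (P + c)/ν`; then `HΩ` is continuous (`SheetRWeakProfilePV.continuous_hilbertTransform_of_contDiff`), `F` has a continuous
representative, `P ∈ C¹`, `Ω ∈ C²`, `νΩ″ = F` pointwise.  WHAT THIS IS NOT: not NS; and not the MODEL ASSEMBLY either (that the certificate's
abstract `(E, G)` data instantiate to (W) stays the hypothesis it is in `CertificateViscousSheetRChain`).
-/

noncomputable section

namespace Summit.NavierStokesRegularity.OSWSelfSimilar
namespace SheetRWeakToStrong

open _root_.MeasureTheory _root_.Set _root_.Filter _root_.Function Literature.Analysis.Fourier Literature.Analysis.FluidPDE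
  SheetRWeakProfilePV
open scoped Real Topology ContDiff

/-! ### Local integrability bookkeeping -/

/-- `L¹_loc · C ⊂ L¹_loc` on the line. [folklore] -/
private theorem locInt_mul_continuous {f g : ℝ → ℝ} (hf : LocallyIntegrable f) (hg : Continuous g) :
    LocallyIntegrable (fun x => f x * g x) := by
  rw [← locallyIntegrableOn_univ] at hf ⊢
  exact hf.mul_continuousOn hg.continuousOn isClosed_univ.isLocallyClosed

/-- `C · L¹_loc ⊂ L¹_loc` on the line. [folklore] -/
private theorem locInt_continuous_mul {f g : ℝ → ℝ} (hg : Continuous g) (hf : LocallyIntegrable f) :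
    LocallyIntegrable (fun x => g x * f x) := by
  rw [← locallyIntegrableOn_univ] at hf ⊢
  exact hf.continuousOn_mul hg.continuousOn isClosed_univ.isLocallyClosed

/-- A compactly supported function on `ℝ` has `tsupport ⊆ (−R, R)` for some `R ≥ 1`. [folklore] -/
private theorem exists_tsupport_subset_Ioo {η : ℝ → ℝ} (hη : HasCompactSupport η) :
    ∃ R : ℝ, 1 ≤ R ∧ tsupport η ⊆ Ioo (-R) R := by
  obtain ⟨r, hr⟩ := hη.isCompact.isBounded.subset_ball 0
  refine ⟨max r 1, le_max_right _ _, hr.trans ?_⟩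
  rw [Real.ball_eq_Ioo, zero_sub, zero_add]
  exact Ioo_subset_Ioo (neg_le_neg (le_max_left _ _)) (le_max_left _ _)

/-! ### Step 1: the right-hand side `F = Ω + ½ξΩ₁ + a𝒰Ω·Ω₁ − HΩ·Ω` is locally integrable -/

/-- For an `H¹`-type profile `Ω = Ω(0) + ∫₀Ω₁`, `Ω₁ ∈ L²`, `Ω ∈ L¹ ∩ L²`, the right-hand side
`F = Ω + ½ξΩ₁ + a·(∫₀^ξ HΩ)·Ω₁ − HΩ·Ω` is locally integrable. [folklore] -/
theorem locallyIntegrable_rhs {a : ℝ} {Ω Ω₁ : ℝ → ℝ} (hΩ : ∀ x, Ω x = Ω 0 + ∫ s in (0 : ℝ)..x, Ω₁ s)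
    (hΩ₁ : MemLp Ω₁ 2) (hΩi : Integrable Ω) (hΩ2 : MemLp Ω 2) :
    LocallyIntegrable fun x => Ω x + 1 / 2 * x * Ω₁ x
      + a * (∫ s in (0 : ℝ)..x, hilbertTransform Ω s) * Ω₁ x - hilbertTransform Ω x * Ω x := by
  have hii : ∀ a b, IntervalIntegrable Ω₁ volume a b := intervalIntegrable_of_memLp_two hΩ₁
  have hΩc : Continuous Ω := continuous_of_primitive hΩ hii
  have hΩ₁loc : LocallyIntegrable Ω₁ := hΩ₁.locallyIntegrable one_le_two
  have hHloc : LocallyIntegrable (hilbertTransform Ω) :=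
    (memLp_two_hilbertTransform_of_primitive hΩ hΩ₁ hΩi hΩ2).1.locallyIntegrable one_le_two
  have hU : Continuous fun ξ => ∫ s in (0 : ℝ)..ξ, hilbertTransform Ω s := continuous_velocity_of_primitive hΩ hΩ₁ hΩi hΩ2
  have h1 : LocallyIntegrable fun x => 1 / 2 * x * Ω₁ x :=
    locInt_continuous_mul (continuous_const.mul continuous_id) hΩ₁loc
  have h2 : LocallyIntegrable fun x => a * (∫ s in (0 : ℝ)..x, hilbertTransform Ω s) * Ω₁ x :=
    locInt_continuous_mul (continuous_const.mul hU) hΩ₁loc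
  have h3 : LocallyIntegrable fun x => hilbertTransform Ω x * Ω x := locInt_mul_continuous hHloc hΩc
  exact ((hΩc.locallyIntegrable.add h1).add h2).sub h3

/-! ### Step 2: integration by parts against the primitive `P = ∫₀ F` of an `L¹_loc` function (whole line) -/

/-- **Integration by parts against a primitive on the line.** For `F ∈ L¹_loc(ℝ)`, `P(x) = ∫₀ˣ F`, and a `C^∞` compactly supported `η`:
`∫ η′·P = −∫ η·F` (absolute continuity of `P` on a window containing the support, Mathlib's AC integration by parts, and
`P′ = F` a.e. by Lebesgue differentiation). [folklore] -/
theorem integral_deriv_mul_primitive {F η : ℝ → ℝ} (hF : LocallyIntegrable F) (hη : ContDiff ℝ ∞ η)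
    (hηc : HasCompactSupport η) :
    ∫ x, deriv η x * (∫ s in (0 : ℝ)..x, F s) = -∫ x, η x * F x := by
  obtain ⟨R, hR1, hsupp⟩ := exists_tsupport_subset_Ioo hηc
  have hR : -R ≤ R := by linarith
  have hFii : ∀ a b, IntervalIntegrable F volume a b := fun a b =>
    (hF.integrableOn_isCompact isCompact_uIcc).intervalIntegrable
  have hη0 : ∀ x, x ∉ Ioo (-R) R → η x = 0 := fun x hx => image_eq_zero_of_notMem_tsupport fun h => hx (hsupp h)
  have hdη0 : ∀ x, x ∉ Ioo (-R) R → deriv η x = 0 := fun x hx => by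
    have : x ∉ tsupport η := fun h => hx (hsupp h)
    exact notMem_support.1 fun h => this (support_deriv_subset h)
  have hηR : η R = 0 := hη0 R fun h => lt_irrefl _ h.2
  have hηmR : η (-R) = 0 := hη0 (-R) fun h => lt_irrefl _ h.1
  have hsub : Ioo (-R) R ⊆ Ioc (-R) R := Ioo_subset_Ioc_self
  have eL : ∫ x, deriv η x * (∫ s in (0 : ℝ)..x, F s) = ∫ x in (-R)..R, (∫ s in (0 : ℝ)..x, F s) * deriv η x := by
    rw [intervalIntegral.integral_of_le hR, ← setIntegral_eq_integral_of_forall_compl_eq_zero (s := Ioc (-R) R)]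
    · exact setIntegral_congr_fun measurableSet_Ioc fun x _ => mul_comm _ _
    · intro x hx; rw [hdη0 x fun h => hx (hsub h), zero_mul]
  have eR : ∫ x, η x * F x = ∫ x in (-R)..R, η x * F x := by
    rw [intervalIntegral.integral_of_le hR, ← setIntegral_eq_integral_of_forall_compl_eq_zero (s := Ioc (-R) R)]
    intro x hx; rw [hη0 x fun h => hx (hsub h), zero_mul]
  have h0mem : (0 : ℝ) ∈ uIcc (-R) R := by
    rw [uIcc_of_le hR]; exact ⟨by linarith, by linarith⟩
  have hPac : AbsolutelyContinuousOnInterval (fun x => ∫ s in (0 : ℝ)..x, F s) (-R) R :=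
    (hFii (-R) R).absolutelyContinuousOnInterval_intervalIntegral h0mem
  have hη1 : ContDiff ℝ 1 η := hη.of_le (by exact_mod_cast le_top)
  have hηac : AbsolutelyContinuousOnInterval η (-R) R := hη1.contDiffOn.absolutelyContinuousOnInterval
  have hibp := hPac.integral_mul_deriv_eq_deriv_mul hηac
  rw [hηR, hηmR, mul_zero, mul_zero, sub_zero, zero_sub] at hibp
  have hae : ∀ᵐ x, deriv (fun x => ∫ s in (0 : ℝ)..x, F s) x = F x := by
    filter_upwards [_root_.LocallyIntegrable.ae_hasDerivAt_integral hF] with x hx using (hx 0).deriv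
  have e3 : ∫ x in (-R)..R, deriv (fun x => ∫ s in (0 : ℝ)..x, F s) x * η x = ∫ x in (-R)..R, η x * F x := by
    refine intervalIntegral.integral_congr_ae ?_
    filter_upwards [hae] with x hx _
    rw [hx, mul_comm]
  rw [eL, eR, hibp, e3]

/-! ### Step 3: du Bois-Reymond on every window — `νΩ₁ = ∫₀F + c` a.e. -/

/-- From the weak equation (W): on every window `(−(n+1), n+1)` the function `νΩ₁ − ∫₀F` is a.e. constant. [folklore] -/
theorem exists_const_ae_restrict_of_weakZero {a ν : ℝ} {Ω Ω₁ : ℝ → ℝ} (hΩ : ∀ x, Ω x = Ω 0 + ∫ s in (0 : ℝ)..x, Ω₁ s)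
    (hΩ₁ : MemLp Ω₁ 2) (hΩi : Integrable Ω) (hΩ2 : MemLp Ω 2)
    (hweak : ∀ ψ : ℝ → ℝ, ContDiff ℝ ∞ ψ → HasCompactSupport ψ →
      (∫ x, (Ω x + 1 / 2 * x * Ω₁ x + a * (∫ s in (0 : ℝ)..x, hilbertTransform Ω s) * Ω₁ x
        - hilbertTransform Ω x * Ω x) * ψ x) + ν * ∫ x, Ω₁ x * deriv ψ x = 0)
    (n : ℕ) :
    ∃ c : ℝ, ∀ᵐ x ∂(volume.restrict (Ioo (-((n : ℝ) + 1)) ((n : ℝ) + 1))),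
      ν * Ω₁ x - ∫ s in (0 : ℝ)..x, (Ω s + 1 / 2 * s * Ω₁ s
        + a * (∫ r in (0 : ℝ)..s, hilbertTransform Ω r) * Ω₁ s - hilbertTransform Ω s * Ω s) = c := by
  set F : ℝ → ℝ := fun x => Ω x + 1 / 2 * x * Ω₁ x
      + a * (∫ s in (0 : ℝ)..x, hilbertTransform Ω s) * Ω₁ x - hilbertTransform Ω x * Ω x with hFdef
  have hFloc : LocallyIntegrable F := locallyIntegrable_rhs hΩ hΩ₁ hΩi hΩ2
  have hFii : ∀ a b, IntervalIntegrable F volume a b := fun a b =>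
    (hFloc.integrableOn_isCompact isCompact_uIcc).intervalIntegrable
  have hΩ₁loc : LocallyIntegrable Ω₁ := hΩ₁.locallyIntegrable one_le_two
  have hPc : Continuous fun x => ∫ s in (0 : ℝ)..x, F s := intervalIntegral.continuous_primitive hFii 0
  set b : ℝ := (n : ℝ) + 1 with hb
  have hEint : IntegrableOn (fun x => ν * Ω₁ x - ∫ s in (0 : ℝ)..x, F s) (Ioo (-b) b) := by
    have h1 : IntegrableOn (fun x => ν * Ω₁ x) (Icc (-b) b) := (hΩ₁loc.integrableOn_isCompact isCompact_Icc).const_mul ν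
    have h2 : IntegrableOn (fun x => ∫ s in (0 : ℝ)..x, F s) (Icc (-b) b) := hPc.continuousOn.integrableOn_compact isCompact_Icc
    exact (h1.sub h2).mono_set Ioo_subset_Icc_self
  refine Literature.Analysis.FunctionSpaces.ae_eq_const_of_forall_setIntegral_deriv_mul_eq_zero hEint fun η hηs hηc hηsupp => ?_
  -- `∫_{window} η′ E = ∫_ℝ η′ E = ν ∫ η′ Ω₁ − ∫ η′ P = −∫ F η + ∫ η F = 0`
  have hdη0 : ∀ x, x ∉ Ioo (-b) b → deriv η x = 0 := fun x hx => by
    have : x ∉ tsupport η := fun h => hx (hηsupp h)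
    exact notMem_support.1 fun h => this (support_deriv_subset h)
  rw [setIntegral_eq_integral_of_forall_compl_eq_zero fun x hx => by rw [hdη0 x hx, zero_mul]]
  have hdc : Continuous (deriv η) := hηs.continuous_deriv (by exact_mod_cast le_top)
  have hdcs : HasCompactSupport (deriv η) := hηc.deriv
  have hi1 : Integrable fun x => deriv η x * Ω₁ x := by
    simpa only [smul_eq_mul] using hΩ₁loc.integrable_smul_left_of_hasCompactSupport hdc hdcs
  have hi2 : Integrable fun x => deriv η x * ∫ s in (0 : ℝ)..x, F s := by
    simpa only [smul_eq_mul] using hPc.locallyIntegrable.integrable_smul_left_of_hasCompactSupport hdc hdcs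
  have hsplit : ∫ x, deriv η x * (ν * Ω₁ x - ∫ s in (0 : ℝ)..x, F s)
      = ν * (∫ x, Ω₁ x * deriv η x) - ∫ x, deriv η x * ∫ s in (0 : ℝ)..x, F s := by
    have : (fun x => deriv η x * (ν * Ω₁ x - ∫ s in (0 : ℝ)..x, F s))
        = fun x => ν * (deriv η x * Ω₁ x) - deriv η x * ∫ s in (0 : ℝ)..x, F s := by funext x; ring
    rw [this, integral_sub (hi1.const_mul ν) hi2, integral_const_mul]
    congr 2
    exact integral_congr_ae (Eventually.of_forall fun x => mul_comm _ _)
  have hW := hweak η hηs hηc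
  have hibp := integral_deriv_mul_primitive hFloc hηs hηc
  have hcomm : ∫ x, η x * F x = ∫ x, F x * η x := integral_congr_ae (Eventually.of_forall fun x => mul_comm _ _)
  rw [hsplit, hibp, hcomm]
  linarith

/-- **`νΩ₁ = ∫₀F + c` almost everywhere** for one constant `c` (the windows' constants agree on `(−1, 1)`). [folklore] -/
theorem exists_const_ae_of_weakZero {a ν : ℝ} {Ω Ω₁ : ℝ → ℝ} (hΩ : ∀ x, Ω x = Ω 0 + ∫ s in (0 : ℝ)..x, Ω₁ s)
    (hΩ₁ : MemLp Ω₁ 2) (hΩi : Integrable Ω) (hΩ2 : MemLp Ω 2)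
    (hweak : ∀ ψ : ℝ → ℝ, ContDiff ℝ ∞ ψ → HasCompactSupport ψ →
      (∫ x, (Ω x + 1 / 2 * x * Ω₁ x + a * (∫ s in (0 : ℝ)..x, hilbertTransform Ω s) * Ω₁ x
        - hilbertTransform Ω x * Ω x) * ψ x) + ν * ∫ x, Ω₁ x * deriv ψ x = 0) :
    ∃ c : ℝ, ∀ᵐ x : ℝ, ν * Ω₁ x - ∫ s in (0 : ℝ)..x, (Ω s + 1 / 2 * s * Ω₁ s
        + a * (∫ r in (0 : ℝ)..s, hilbertTransform Ω r) * Ω₁ s - hilbertTransform Ω s * Ω s) = c := by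
  set E : ℝ → ℝ := fun x => ν * Ω₁ x - ∫ s in (0 : ℝ)..x, (Ω s + 1 / 2 * s * Ω₁ s
        + a * (∫ r in (0 : ℝ)..s, hilbertTransform Ω r) * Ω₁ s - hilbertTransform Ω s * Ω s) with hE
  have hwin := exists_const_ae_restrict_of_weakZero hΩ hΩ₁ hΩi hΩ2 hweak
  choose c hc using hwin
  refine ⟨c 0, ?_⟩
  -- all window constants coincide with `c 0`
  have hcc : ∀ n, c n = c 0 := by
    intro n
    have hsub : Ioo (-(((0 : ℕ) : ℝ) + 1)) (((0 : ℕ) : ℝ) + 1) ⊆ Ioo (-((n : ℝ) + 1)) ((n : ℝ) + 1) := by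
      refine Ioo_subset_Ioo ?_ ?_ <;> push_cast <;> linarith [n.cast_nonneg (α := ℝ)]
    have h1 : ∀ᵐ x ∂(volume.restrict (Ioo (-(((0 : ℕ) : ℝ) + 1)) (((0 : ℕ) : ℝ) + 1))), E x = c n :=
      ae_restrict_of_ae_restrict_of_subset hsub (hc n)
    have h2 := (h1.and (hc 0))
    have hne : (ae (volume.restrict (Ioo (-(((0 : ℕ) : ℝ) + 1)) (((0 : ℕ) : ℝ) + 1)))).NeBot := by
      rw [ae_neBot, Ne, Measure.restrict_eq_zero]
      push_cast
      rw [Real.volume_Ioo]; norm_num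
    obtain ⟨x, hx1, hx2⟩ := h2.exists
    exact hx1.symm.trans hx2
  have hcover : (⋃ n : ℕ, Ioo (-((n : ℝ) + 1)) ((n : ℝ) + 1)) = univ := by
    refine eq_univ_of_forall fun x => mem_iUnion.2 ?_
    obtain ⟨n, hn⟩ := exists_nat_gt |x|
    exact ⟨n, by rw [mem_Ioo]; constructor <;> linarith [abs_lt.1 (hn.trans (lt_add_one _))]⟩
  have h : ∀ᵐ x ∂(volume.restrict (⋃ n : ℕ, Ioo (-((n : ℝ) + 1)) ((n : ℝ) + 1))), E x = c 0 := by
    rw [ae_restrict_iUnion_iff]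
    intro n
    have h := hc n
    rw [hcc n] at h
    exact h
  rwa [hcover, Measure.restrict_univ] at h

/-! ### Step 4: first round — `Ω ∈ C¹` with the continuous derivative `(∫₀F + c)/ν` -/

/-- **First round of the bootstrap.** Under (W) with `ν ≠ 0` there is a constant `c` such that, with `P = ∫₀F`, the continuous function
`Q = (P + c)/ν` is the derivative of `Ω` at EVERY point and `Ω₁ = Q` a.e. [folklore] -/
theorem hasDerivAt_of_weakZero {a ν : ℝ} {Ω Ω₁ : ℝ → ℝ} (hν : ν ≠ 0) (hΩ : ∀ x, Ω x = Ω 0 + ∫ s in (0 : ℝ)..x, Ω₁ s)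
    (hΩ₁ : MemLp Ω₁ 2) (hΩi : Integrable Ω) (hΩ2 : MemLp Ω 2)
    (hweak : ∀ ψ : ℝ → ℝ, ContDiff ℝ ∞ ψ → HasCompactSupport ψ →
      (∫ x, (Ω x + 1 / 2 * x * Ω₁ x + a * (∫ s in (0 : ℝ)..x, hilbertTransform Ω s) * Ω₁ x
        - hilbertTransform Ω x * Ω x) * ψ x) + ν * ∫ x, Ω₁ x * deriv ψ x = 0) :
    ∃ c : ℝ, (∀ᵐ x : ℝ, Ω₁ x = ((∫ s in (0 : ℝ)..x, (Ω s + 1 / 2 * s * Ω₁ s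
        + a * (∫ r in (0 : ℝ)..s, hilbertTransform Ω r) * Ω₁ s - hilbertTransform Ω s * Ω s)) + c) / ν) ∧
      ∀ x, HasDerivAt Ω (((∫ s in (0 : ℝ)..x, (Ω s + 1 / 2 * s * Ω₁ s
        + a * (∫ r in (0 : ℝ)..s, hilbertTransform Ω r) * Ω₁ s - hilbertTransform Ω s * Ω s)) + c) / ν) x := by
  set F : ℝ → ℝ := fun x => Ω x + 1 / 2 * x * Ω₁ x
      + a * (∫ s in (0 : ℝ)..x, hilbertTransform Ω s) * Ω₁ x - hilbertTransform Ω x * Ω x with hFdef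
  obtain ⟨c, hc⟩ := exists_const_ae_of_weakZero hΩ hΩ₁ hΩi hΩ2 hweak
  have hFloc : LocallyIntegrable F := locallyIntegrable_rhs hΩ hΩ₁ hΩi hΩ2
  have hFii : ∀ a b, IntervalIntegrable F volume a b := fun a b =>
    (hFloc.integrableOn_isCompact isCompact_uIcc).intervalIntegrable
  have hPc : Continuous fun x => ∫ s in (0 : ℝ)..x, F s := intervalIntegral.continuous_primitive hFii 0
  set Q : ℝ → ℝ := fun x => ((∫ s in (0 : ℝ)..x, F s) + c) / ν with hQ
  have hQc : Continuous Q := (hPc.add continuous_const).div_const ν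
  have hae : ∀ᵐ x : ℝ, Ω₁ x = Q x := by
    filter_upwards [hc] with x hx
    rw [hQ]; simp only
    field_simp
    linarith
  refine ⟨c, hae, fun x => ?_⟩
  have hii : ∀ a b, IntervalIntegrable Ω₁ volume a b := intervalIntegrable_of_memLp_two hΩ₁
  -- `Ω = Ω(0) + ∫₀ Q`
  have hΩQ : Ω = fun y => Ω 0 + ∫ s in (0 : ℝ)..y, Q s := by
    funext y
    rw [hΩ y]
    congr 1
    exact intervalIntegral.integral_congr_ae (hae.mono fun s hs _ => hs)
  rw [hΩQ]
  exact ((hQc.integral_hasStrictDerivAt 0 x).hasDerivAt).const_add _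

/-! ### Step 5: second round — `Ω ∈ C²` and the strong equation -/

/-- **Weak zero ⇒ `C²` strong zero.** For an `H¹`-type profile `Ω = Ω(0) + ∫₀Ω₁` with `Ω₁ ∈ L²`, `Ω ∈ L¹ ∩ L²`, `ν ≠ 0`, satisfying
the weak profile equation (W) against all `C_c^∞` tests, `Ω` is `C²` and is a POINTWISE zero of the certificate's map:
`Ω(X) + ½X·Ω′(X) + a·(∫₀^X HΩ)·Ω′(X) − HΩ(X)·Ω(X) − ν·Ω″(X) = 0` for every `X` (`H = hilbertTransform`, `Ω′ = deriv Ω`,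
`Ω″ = iteratedDeriv 2 Ω`). MODEL statement (1-D viscous gCLM); the existence of such an `Ω` is NOT asserted. [folklore] -/
theorem contDiff_two_and_strongZero_of_weakZero {a ν : ℝ} {Ω Ω₁ : ℝ → ℝ} (hν : ν ≠ 0)
    (hΩ : ∀ x, Ω x = Ω 0 + ∫ s in (0 : ℝ)..x, Ω₁ s) (hΩ₁ : MemLp Ω₁ 2) (hΩi : Integrable Ω) (hΩ2 : MemLp Ω 2)
    (hweak : ∀ ψ : ℝ → ℝ, ContDiff ℝ ∞ ψ → HasCompactSupport ψ →
      (∫ x, (Ω x + 1 / 2 * x * Ω₁ x + a * (∫ s in (0 : ℝ)..x, hilbertTransform Ω s) * Ω₁ x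
        - hilbertTransform Ω x * Ω x) * ψ x) + ν * ∫ x, Ω₁ x * deriv ψ x = 0) :
    ContDiff ℝ 2 Ω ∧ ∀ X : ℝ, Ω X + 1 / 2 * X * deriv Ω X
      + a * (∫ s in (0 : ℝ)..X, hilbertTransform Ω s) * deriv Ω X
      - hilbertTransform Ω X * Ω X - ν * iteratedDeriv 2 Ω X = 0 := by
  set H : ℝ → ℝ := hilbertTransform Ω with hH
  set U : ℝ → ℝ := fun x => ∫ s in (0 : ℝ)..x, H s with hU
  set F : ℝ → ℝ := fun x => Ω x + 1 / 2 * x * Ω₁ x + a * U x * Ω₁ x - H x * Ω x with hFdef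
  obtain ⟨c, hae, hder⟩ := hasDerivAt_of_weakZero hν hΩ hΩ₁ hΩi hΩ2 hweak
  set Q : ℝ → ℝ := fun x => ((∫ s in (0 : ℝ)..x, F s) + c) / ν with hQ
  change ∀ᵐ x : ℝ, Ω₁ x = Q x at hae
  change ∀ x, HasDerivAt Ω (Q x) x at hder
  have hFloc : LocallyIntegrable F := locallyIntegrable_rhs hΩ hΩ₁ hΩi hΩ2
  have hFii : ∀ a b, IntervalIntegrable F volume a b := fun a b =>
    (hFloc.integrableOn_isCompact isCompact_uIcc).intervalIntegrable
  have hPc : Continuous fun x => ∫ s in (0 : ℝ)..x, F s := intervalIntegral.continuous_primitive hFii 0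
  have hQc : Continuous Q := (hPc.add continuous_const).div_const ν
  have hderiv : deriv Ω = Q := funext fun x => (hder x).deriv
  have hdiff : Differentiable ℝ Ω := fun x => (hder x).differentiableAt
  have hC1 : ContDiff ℝ 1 Ω := contDiff_one_iff_deriv.2 ⟨hdiff, by rw [hderiv]; exact hQc⟩
  have hΩc : Continuous Ω := hC1.continuous
  -- continuity of `HΩ` and of the velocity
  have hHc : Continuous H := continuous_hilbertTransform_of_contDiff hC1 hΩi
  have hUc : Continuous U := continuous_velocity_of_primitive hΩ hΩ₁ hΩi hΩ2
  -- the continuous representative of `F`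
  set F₂ : ℝ → ℝ := fun x => Ω x + 1 / 2 * x * Q x + a * U x * Q x - H x * Ω x with hF₂
  have hF₂c : Continuous F₂ :=
    ((hΩc.add ((continuous_const.mul continuous_id).mul hQc)).add ((continuous_const.mul hUc).mul hQc)).sub (hHc.mul hΩc)
  have hFF₂ : ∀ᵐ x : ℝ, F x = F₂ x := by
    filter_upwards [hae] with x hx
    simp only [hFdef, hF₂, hx]
  have hPeq : (fun x => ∫ s in (0 : ℝ)..x, F s) = fun x => ∫ s in (0 : ℝ)..x, F₂ s :=
    funext fun x => intervalIntegral.integral_congr_ae (hFF₂.mono fun s hs _ => hs)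
  -- second round: `Q` is `C¹` with `Q′ = F₂/ν`
  have hQder : ∀ x, HasDerivAt Q (F₂ x / ν) x := by
    intro x
    have hP : HasDerivAt (fun y => ∫ s in (0 : ℝ)..y, F s) (F₂ x) x := by
      rw [hPeq]; exact (hF₂c.integral_hasStrictDerivAt 0 x).hasDerivAt
    have := (hP.add_const c).div_const ν
    simpa only [hQ] using this
  have hQderiv : deriv Q = fun x => F₂ x / ν := funext fun x => (hQder x).deriv
  have hQC1 : ContDiff ℝ 1 Q :=
    contDiff_one_iff_deriv.2 ⟨fun x => (hQder x).differentiableAt, by rw [hQderiv]; exact hF₂c.div_const ν⟩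
  have hC2 : ContDiff ℝ 2 Ω := by
    show ContDiff ℝ (1 + 1) Ω
    refine contDiff_succ_iff_deriv.2 ⟨hdiff, fun h => ?_, by rw [hderiv]; exact hQC1⟩
    simp at h
  refine ⟨hC2, fun X => ?_⟩
  have h2 : iteratedDeriv 2 Ω X = F₂ X / ν := by
    rw [iteratedDeriv_succ, iteratedDeriv_one, hderiv, hQderiv]
  rw [h2, hderiv]
  simp only [hF₂]
  field_simp
  ring

/-! ### The bridge composed with the blow-up theorem -/

/-- **Weak zero ⇒ exact self-similar viscous gCLM blow-up.** An `H¹`-type profile `Ω = Ω(0) + ∫₀Ω₁` (`Ω₁ ∈ L²`, `Ω ∈ L¹ ∩ L²`),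
not identically zero, satisfying the WEAK profile equation (W) of the certificate's map `G(Ω) = Ω + ½ξΩ′ + a𝒰Ω·Ω′ − (HΩ)Ω − νΩ″` (`ν ≠ 0`)
against all `C_c^∞` tests gives, for every `T > 0`, an exact self-similar classical solution `ω(t,x) = (T − t)⁻¹Ω(x/√(T − t))` of the
viscous gCLM `ω_t + a u ω_x = u_x ω + ν ω_xx` on `ℝ × [0,T)` whose sup norm blows up at `T`
(`SheetRStrongZeroBlowup.exact_viscous_selfSimilar_blowup_of_strongZero` after the bootstrap). MODEL statement; no profile is asserted to exist.
[folklore] -/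
theorem exact_viscous_selfSimilar_blowup_of_weakZero {a ν T : ℝ} {Ω Ω₁ : ℝ → ℝ} (hT : 0 < T) (hν : ν ≠ 0)
    (hΩ : ∀ x, Ω x = Ω 0 + ∫ s in (0 : ℝ)..x, Ω₁ s) (hΩ₁ : MemLp Ω₁ 2) (hΩi : Integrable Ω) (hΩ2 : MemLp Ω 2)
    (hweak : ∀ ψ : ℝ → ℝ, ContDiff ℝ ∞ ψ → HasCompactSupport ψ →
      (∫ x, (Ω x + 1 / 2 * x * Ω₁ x + a * (∫ s in (0 : ℝ)..x, hilbertTransform Ω s) * Ω₁ x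
        - hilbertTransform Ω x * Ω x) * ψ x) + ν * ∫ x, Ω₁ x * deriv ψ x = 0)
    {X₀ : ℝ} (hX₀ : Ω X₀ ≠ 0) :
    IsGCLMLineSolution a ν (gclmSelfSimilar (-1) (1 / 2) T Ω) T ∧
      SupNormBlowupBefore (gclmSelfSimilar (-1) (1 / 2) T Ω) T := by
  obtain ⟨hC2, hG⟩ := contDiff_two_and_strongZero_of_weakZero hν hΩ hΩ₁ hΩi hΩ2 hweak
  exact SheetRStrongZeroBlowup.exact_viscous_selfSimilar_blowup_of_strongZero hT hC2 hΩi hG hX₀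

/-! ### The certificate's literal data: `E = H¹_{L²+ξ²}` -/

/-- `∫(L² + y²)g² < ∞` with `g` a.e.-strongly measurable and `L > 0` gives `g ∈ L²`. [folklore] -/
theorem memLp_two_of_weighted_sq {L : ℝ} (hL : 0 < L) {g : ℝ → ℝ} (hm : AEStronglyMeasurable g volume)
    (hw : Integrable fun y => (L ^ 2 + y ^ 2) * g y ^ 2) : MemLp g 2 := by
  rw [memLp_two_iff_integrable_sq hm]
  refine ((hw.div_const (L ^ 2)).mono' (hm.pow 2) (Eventually.of_forall fun y => ?_))
  rw [Real.norm_eq_abs, abs_of_nonneg (sq_nonneg _), le_div_iff₀ (by positivity)]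
  nlinarith [sq_nonneg y, sq_nonneg (g y), mul_nonneg (sq_nonneg y) (sq_nonneg (g y))]

/-- **The bridge for the certificate's literal energy data.** Let `Ω = ∫₀^ξ Ω₁` (so `Ω(0) = 0`, as for the odd profiles of the certificate)
with `Ω₁` a.e.-strongly measurable, `∫(L² + ξ²)Ω² < ∞`, `∫(L² + ξ²)Ω₁² < ∞` (`Ω ∈ E = H¹_{L²+ξ²}`, `L > 0`), `ν ≠ 0`, and assume the weak
profile equation (W). Then `Ω ∈ C² ∩ L¹` is a pointwise zero of `G`, and if `Ω ≢ 0` the self-similar viscous gCLM solution with profile `Ω`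
blows up at every prescribed `T > 0`. (The `L¹ ∩ L²` clauses come from `SheetRWeightedEmbeddings.integrable_of_weighted_sq`.) MODEL statement.
[folklore] -/
theorem exact_viscous_selfSimilar_blowup_of_energyData {a ν T L : ℝ} {Ω Ω₁ : ℝ → ℝ} (hT : 0 < T) (hν : ν ≠ 0) (hL : 0 < L)
    (hΩ : ∀ x, Ω x = ∫ s in (0 : ℝ)..x, Ω₁ s) (hΩ₁m : AEStronglyMeasurable Ω₁ volume)
    (hwΩ : Integrable fun y => (L ^ 2 + y ^ 2) * Ω y ^ 2) (hwΩ₁ : Integrable fun y => (L ^ 2 + y ^ 2) * Ω₁ y ^ 2)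
    (hweak : ∀ ψ : ℝ → ℝ, ContDiff ℝ ∞ ψ → HasCompactSupport ψ →
      (∫ x, (Ω x + 1 / 2 * x * Ω₁ x + a * (∫ s in (0 : ℝ)..x, hilbertTransform Ω s) * Ω₁ x
        - hilbertTransform Ω x * Ω x) * ψ x) + ν * ∫ x, Ω₁ x * deriv ψ x = 0)
    {X₀ : ℝ} (hX₀ : Ω X₀ ≠ 0) :
    (ContDiff ℝ 2 Ω ∧ Integrable Ω ∧ ∀ X : ℝ, Ω X + 1 / 2 * X * deriv Ω X
      + a * (∫ s in (0 : ℝ)..X, hilbertTransform Ω s) * deriv Ω X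
      - hilbertTransform Ω X * Ω X - ν * iteratedDeriv 2 Ω X = 0) ∧
    (IsGCLMLineSolution a ν (gclmSelfSimilar (-1) (1 / 2) T Ω) T ∧
      SupNormBlowupBefore (gclmSelfSimilar (-1) (1 / 2) T Ω) T) := by
  have hΩ₁2 : MemLp Ω₁ 2 := memLp_two_of_weighted_sq hL hΩ₁m hwΩ₁
  have hΩ' : ∀ x, Ω x = Ω 0 + ∫ s in (0 : ℝ)..x, Ω₁ s := fun x => by
    rw [hΩ x, hΩ 0, intervalIntegral.integral_same, zero_add]
  have hΩc : Continuous Ω := continuous_of_primitive hΩ' (intervalIntegrable_of_memLp_two hΩ₁2)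
  have hΩi : Integrable Ω := SheetRWeightedEmbeddings.integrable_of_weighted_sq hL hΩc.aestronglyMeasurable hwΩ
  have hΩ2 : MemLp Ω 2 := memLp_two_of_weighted_sq hL hΩc.aestronglyMeasurable hwΩ
  obtain ⟨hC2, hG⟩ := contDiff_two_and_strongZero_of_weakZero hν hΩ' hΩ₁2 hΩi hΩ2 hweak
  exact ⟨⟨hC2, hΩi, hG⟩, SheetRStrongZeroBlowup.exact_viscous_selfSimilar_blowup_of_strongZero hT hC2 hΩi hG hX₀⟩

/-- **The certified point `(a, ν) = (1/5, 1)`** (the map of `CertificateViscousSheetR.lean`): an odd-normalised (`Ω(0) = 0`) energy-class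
weak zero `Ω ≢ 0` of `G(Ω) = Ω + ½ξΩ′ + (1/5)𝒰Ω·Ω′ − (HΩ)Ω − Ω″` is a `C²` strong zero and yields an exact self-similar viscous gCLM blow-up at every
`T > 0`. MODEL statement; whether the certified `E`-ball zero of record satisfies (W) is the MODEL-ASSEMBLY hypothesis of
`CertificateViscousSheetRChain`, not proved here. [folklore] -/
theorem exact_viscous_selfSimilar_blowup_of_energyData_fifth {T L : ℝ} {Ω Ω₁ : ℝ → ℝ} (hT : 0 < T) (hL : 0 < L)
    (hΩ : ∀ x, Ω x = ∫ s in (0 : ℝ)..x, Ω₁ s) (hΩ₁m : AEStronglyMeasurable Ω₁ volume)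
    (hwΩ : Integrable fun y => (L ^ 2 + y ^ 2) * Ω y ^ 2) (hwΩ₁ : Integrable fun y => (L ^ 2 + y ^ 2) * Ω₁ y ^ 2)
    (hweak : ∀ ψ : ℝ → ℝ, ContDiff ℝ ∞ ψ → HasCompactSupport ψ →
      (∫ x, (Ω x + 1 / 2 * x * Ω₁ x + 1 / 5 * (∫ s in (0 : ℝ)..x, hilbertTransform Ω s) * Ω₁ x
        - hilbertTransform Ω x * Ω x) * ψ x) + ∫ x, Ω₁ x * deriv ψ x = 0)
    {X₀ : ℝ} (hX₀ : Ω X₀ ≠ 0) :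
    IsGCLMLineSolution (1 / 5) 1 (gclmSelfSimilar (-1) (1 / 2) T Ω) T ∧
      SupNormBlowupBefore (gclmSelfSimilar (-1) (1 / 2) T Ω) T :=
  (exact_viscous_selfSimilar_blowup_of_energyData hT one_ne_zero hL hΩ hΩ₁m hwΩ hwΩ₁
    (fun ψ hψ hψc => by rw [one_mul]; exact hweak ψ hψ hψc) hX₀).2

end SheetRWeakToStrong
end Summit.NavierStokesRegularity.OSWSelfSimilar

end
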